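import Summits.ValiantsHypothesis.ValiantsHypothesis.Theorems.EquivariantDialLayersDepthWindow
import Summits.ValiantsHypothesis.ValiantsHypothesis.Theorems.EquivariantDialLayersSuperlinear
import HarnessLib

/-!
# Survivors of the apolar cut are deep and windowed: types of a window-stable degree-`d` cut of `per_{pq}`

Support for the census cell W36 (leaf `R^lay = IdealWidthSuperpoly biPermSubst`) only; `IdealWidthSuperpoly`,
`EqHardLayered biPermSubst` (`A^lay`), `EqHardBiPerm` (cell A), stmt-ValiantsHypothesis-23702 and `VP ≠ VNP` are untouched
and proved by nothing here; mechanism KNOWN (coefficient/apolarity pairing = transpose of a monomial substitution; isotypic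
projectors, Serre §2.6 Thm 8; Pieri–Young depth window); inside the catalogued equivariance barrier (Landsberg–Ressayre 2017,
Dawar–Wilsenach 2020). Lane `--supports`: nothing here closes a route item. File R4b of the «block-witness apolar bound»
programme (`EquivariantDialLayers`).  ARGUMENT (`m = pq`, `e : [m] ≃ [p] × [q]`, root-of-unity weights `ε`, `δ`: nowhere
zero, power sums of orders `1..d` vanish as `d < q, p`): `I = (blockSubst e ε δ)⁻¹((z_k²)_k) ∌ per_m` (`…BlockWitness`), so a
window-stable cut `s` has `f ∉ I` and some `g = P_{χ^λ ⊠ χ^μ} f ∉ I` in `W = span s`; then (i) `f^λ f^μ ≤ dim W ≤ #s`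
(`…Superlinear`); (ii) `λ₁, μ₁ ≥ m - d` (`…DepthWindow`); (iii) `⟨g, u⟩ ≠ 0` for a product `u` of `d` fibre forms indexed
by `μ'` (`…ApolarPairing`), so the `χ^λ ⊠ χ^μ`-component of `u` in its cyclic module is non-zero, while the row / column
Young symmetrisers kill it unless `#rows(μ') ≤ m - λ₁`, `#cols(μ') ≤ m - μ₁` (`…ApolarForms`, `…ApolarKill`); and
`d = #μ' ≤ #rows · #cols`. References: [cite: SerreLinearRepresentations1977, §2.6 Thm. 8];
[cite: BurgisserEtAl2011, Prop. 4.5.4]; [cite: JamesLiebeck2001, 29.13 (Young's rule)].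
-/

set_option linter.dupNamespace false

namespace Summit.ValiantsHypothesis.ValiantsHypothesis.Theorems.EquivariantDialLayersApolarSurvivors

open MvPolynomial Literature.Computability.AlgebraicComplexity
open Equiv (Perm)
open Literature.RepresentationTheory.FiniteGroups Literature.NumberTheory.DiophantineGeometry
open EquivariantDialNode EquivariantDialLayers EquivariantDialLayersBlockWitness EquivariantDialLayersCharacters
open EquivariantDialLayersQuadricTypes EquivariantDialLayersSuperlinear EquivariantDialLayersApolarKill
open EquivariantDialLayersApolarForms EquivariantDialLayersApolarPairing EquivariantDialLayersDepthWindow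

/-! ## §1 Weights -/

/-- Powers of a primitive `q`-th root of unity are nowhere zero and their power sums of orders `1 ≤ k ≤ d < q`
vanish (`∑_c (ζ^k)^c = 0` for `ζ^k ≠ 1`). [textbook] -/
theorem exists_powSum_free_weights (q d : ℕ) (hdq : d < q) :
    ∃ ε : Fin q → ℂ, (∀ c, ε c ≠ 0) ∧ ∀ k : ℕ, 1 ≤ k → k ≤ d → ∑ c, ε c ^ k = 0 := by
  have hq0 : q ≠ 0 := by omega
  set ζ : ℂ := Complex.exp (2 * Real.pi * Complex.I / q)
  have hζ : IsPrimitiveRoot ζ q := Complex.isPrimitiveRoot_exp q hq0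
  refine ⟨fun c => ζ ^ (c : ℕ), fun c => pow_ne_zero _ (hζ.ne_zero hq0), fun k hk hkd => ?_⟩
  have hk1 : ζ ^ k ≠ 1 := by
    rw [Ne, hζ.pow_eq_one_iff_dvd]
    intro hd
    have := Nat.le_of_dvd (by omega) hd
    omega
  have hkq : (ζ ^ k) ^ q = 1 := by rw [← pow_mul, mul_comm, pow_mul, hζ.pow_eq_one, one_pow]
  have hgeom := mul_geom_sum (ζ ^ k) q
  rw [hkq, sub_self, mul_eq_zero, ← Fin.sum_univ_eq_sum_range] at hgeom
  have hpow : ∀ i : ℕ, (ζ ^ i) ^ k = (ζ ^ k) ^ i := fun i => by rw [← pow_mul, ← pow_mul, mul_comm]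
  simp_rw [hpow]
  exact hgeom.resolve_left (sub_ne_zero.2 hk1)

/-! ## §2 Row and column vectors of the fibre forms -/

section Vectors

variable {m p q : ℕ} (e : Fin m ≃ Fin p × Fin q) (ε : Fin q → ℂ) (δ : Fin p → ℂ)

/-- Power sums of a row vector of a fibre form: `∑_a v_k(a)^j = ∑_c ε_c^j`. [folklore] -/
theorem sum_rowVec_pow_eq_zero {k : ℕ} (hk : k ≠ 0) (hε : ∑ c, ε c ^ k = 0) (r : Fin p) :
    ∑ a : Fin m, (if (e a).1 = r then ε (e a).2 else 0) ^ k = 0 :=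
  calc ∑ a : Fin m, (if (e a).1 = r then ε (e a).2 else 0) ^ k
      = ∑ y : Fin p × Fin q, (if y.1 = r then ε y.2 else 0) ^ k :=
        e.sum_comp (fun y : Fin p × Fin q => (if y.1 = r then ε y.2 else 0) ^ k)
    _ = ∑ y : Fin p × Fin q, if y.1 = r then ε y.2 ^ k else 0 :=
        Finset.sum_congr rfl fun y _ => by rw [ite_pow, zero_pow hk]
    _ = ∑ c : Fin q, ∑ r' : Fin p, if r' = r then ε c ^ k else 0 := by
        simp only [Fintype.sum_prod_type]; exact Finset.sum_comm
    _ = 0 := by simp only [Fintype.sum_ite_eq', hε]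

/-- Power sums of a column vector of a fibre form (the row case for the transposed box `e.trans prodComm`). [folklore] -/
theorem sum_colVec_pow_eq_zero {k : ℕ} (hk : k ≠ 0) (hδ : ∑ r, δ r ^ k = 0) (c : Fin q) :
    ∑ b : Fin m, (if (e b).2 = c then δ (e b).1 else 0) ^ k = 0 :=
  sum_rowVec_pow_eq_zero (e.trans (Equiv.prodComm (Fin p) (Fin q))) δ hk hδ c

/-- Two row vectors are equal or disjointly supported. [folklore] -/
theorem rowVec_eq_or_disjoint (k k' : Fin p × Fin q) :
    (fun a : Fin m => if (e a).1 = k.1 then ε (e a).2 else 0) = (fun a => if (e a).1 = k'.1 then ε (e a).2 else 0) ∨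
      ∀ a : Fin m, (if (e a).1 = k.1 then ε (e a).2 else 0) = 0 ∨ (if (e a).1 = k'.1 then ε (e a).2 else 0) = 0 := by
  by_cases h : k.1 = k'.1
  · exact Or.inl (funext fun a => by rw [h])
  · refine Or.inr fun a => ?_
    by_cases ha : (e a).1 = k.1
    · exact Or.inr (if_neg fun h' => h (ha.symm.trans h'))
    · exact Or.inl (if_neg ha)

/-- Two column vectors are equal or disjointly supported. [folklore] -/
theorem colVec_eq_or_disjoint (k k' : Fin p × Fin q) :
    (fun b : Fin m => if (e b).2 = k.2 then δ (e b).1 else 0) = (fun b => if (e b).2 = k'.2 then δ (e b).1 else 0) ∨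
      ∀ b : Fin m, (if (e b).2 = k.2 then δ (e b).1 else 0) = 0 ∨ (if (e b).2 = k'.2 then δ (e b).1 else 0) = 0 :=
  rowVec_eq_or_disjoint (e.trans (Equiv.prodComm (Fin p) (Fin q))) δ k.swap k'.swap

/-- A row vector (nowhere-zero weights) determines its row class. [folklore] -/
theorem fst_eq_of_rowVec_eq (hε0 : ∀ c, ε c ≠ 0) (c₀ : Fin q) {r r' : Fin p}
    (h : (fun a : Fin m => if (e a).1 = r then ε (e a).2 else 0) = fun a => if (e a).1 = r' then ε (e a).2 else 0) :
    r = r' := by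
  by_contra hne
  have h1 := congrFun h (e.symm (r, c₀))
  rw [Equiv.apply_symm_apply, if_pos rfl, if_neg hne] at h1
  exact hε0 c₀ h1

/-- A column vector (nowhere-zero weights) determines its column class. [folklore] -/
theorem snd_eq_of_colVec_eq (hδ0 : ∀ r, δ r ≠ 0) (r₀ : Fin p) {c c' : Fin q}
    (h : (fun b : Fin m => if (e b).2 = c then δ (e b).1 else 0) = fun b => if (e b).2 = c' then δ (e b).1 else 0) :
    c = c' :=
  fst_eq_of_rowVec_eq (e.trans (Equiv.prodComm (Fin p) (Fin q))) δ hδ0 r₀ h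

end Vectors

/-- An injective section of `f` over `f '' s`, indexed by `Fin n`, `n = #(f '' s)`. [folklore] -/
theorem exists_section_injective {α β : Type*} [DecidableEq β] (s : Finset α) (f : α → β) {n : ℕ}
    (hn : n = (s.image f).card) :
    ∃ rep : Fin n → α, (∀ j, rep j ∈ s) ∧ Function.Injective fun j => f (rep j) := by
  have hsec : ∀ b : ↥(s.image f), ∃ a ∈ s, f a = (b : β) := fun b => Finset.mem_image.1 b.2
  choose g hgs hgf using hsec
  refine ⟨fun j => g ((Finset.equivFinOfCardEq hn.symm).symm j), fun j => hgs _, fun j j' h => ?_⟩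
  exact (Finset.equivFinOfCardEq hn.symm).symm.injective (Subtype.ext (by rw [← hgf, ← hgf]; exact h))

/-! ## §3 Row / column depth bounds for surviving products of fibre forms -/

section Bounds

variable {m p q : ℕ} (e : Fin m ≃ Fin p × Fin q) (ε : Fin q → ℂ) (δ : Fin p → ℂ)
  {W : Submodule ℂ (MvPolynomial (Fin m × Fin m) ℂ)} [FiniteDimensional ℂ W]
  (ρ : Representation ℂ (Perm (Fin m) × Perm (Fin m)) W)
  (hρ : ∀ (g : Perm (Fin m) × Perm (Fin m)) (x : W),
    ((ρ g x : W) : MvPolynomial (Fin m × Fin m) ℂ) = rename (Equiv.prodCongr g.1 g.2) (x : MvPolynomial _ ℂ))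

include hρ in
/-- ROW DEPTH BOUND: if `μ'` (`#μ' ≤ d`) has `a + 1` row classes (`2a ≤ m`) and the `χ^λ ⊠ χ^μ`-component of
`u_{μ'} = ∏_{k ∈ μ'} ℓ(v_k, w_k)` in a stable module is non-zero then `λ₁ + (a + 1) ≤ m` (row orbit sums over `𝔖_{m-a}`
vanish, `EquivariantDialLayersApolarForms`; box-product kill, `EquivariantDialLayersApolarKill`). [cite: SerreLinearRepresentations1977, §2.6 Thm. 8] -/
theorem getD_add_card_image_fst_le {d a : ℕ} {la mu : Nat.Partition m} (hq : 0 < q) (hε0 : ∀ c, ε c ≠ 0)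
    (hε : ∀ k : ℕ, 1 ≤ k → k ≤ d → ∑ c, ε c ^ k = 0) (μ' : Finset (Fin p × Fin q)) (hμ : μ'.card ≤ d)
    (ha : (μ'.image Prod.fst).card = a + 1) (h2a : 2 * a ≤ m)
    (hu : (∏ i : ↥μ', ∑ x : Fin m × Fin m, C ((if (e x.1).1 = i.1.1 then ε (e x.1).2 else 0) *
      (if (e x.2).2 = i.1.2 then δ (e x.2).1 else 0)) * X x) ∈ W)
    (hP : isotypicProj ρ (fun t => spechtCharacter ℂ la t.1 * spechtCharacter ℂ mu t.2) ⟨_, hu⟩ ≠ 0) :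
    la.sortedParts.getD 0 0 + (a + 1) ≤ m := by
  classical
  obtain ⟨rep, hrepμ, hrep⟩ := exists_section_injective μ' Prod.fst ha.symm
  have ham : a ≤ m := by omega
  obtain ⟨er, -⟩ := exists_splitting_fixing_finset ham ∅ (by simp)
  by_contra hle
  refine hP (boxProd_isotypicProj_eq_zero_of_row ρ er h2a (by omega) fun g => ?_)
  apply Subtype.ext
  rw [Submodule.coe_sum, Submodule.coe_zero]
  simp only [hρ]
  exact sum_rename_prod_linForm_eq_zero_of_row er
    (fun (i : ↥μ') (y : Fin m) => if (e y).1 = i.1.1 then ε (e y).2 else 0)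
    (fun i j => rowVec_eq_or_disjoint e ε i.1 j.1)
    (fun i k hk hkd => sum_rowVec_pow_eq_zero e ε (by omega) (hε k hk hkd) i.1.1)
    (by rw [Fintype.card_coe]; exact hμ) (fun j => ⟨rep j, hrepμ j⟩)
    (fun j j' hjj => hrep (fst_eq_of_rowVec_eq e ε hε0 ⟨0, hq⟩ hjj))
    (fun (i : ↥μ') (y : Fin m) => if (e y).2 = i.1.2 then δ (e y).1 else 0) g

include hρ in
/-- COLUMN DEPTH BOUND (twin of the row bound, `EquivariantDialLayersApolarKill.boxProd_isotypicProj_eq_zero_of_col`).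
[cite: SerreLinearRepresentations1977, §2.6 Thm. 8] -/
theorem getD_add_card_image_snd_le {d a : ℕ} {la mu : Nat.Partition m} (hp : 0 < p) (hδ0 : ∀ r, δ r ≠ 0)
    (hδ : ∀ k : ℕ, 1 ≤ k → k ≤ d → ∑ r, δ r ^ k = 0) (μ' : Finset (Fin p × Fin q)) (hμ : μ'.card ≤ d)
    (ha : (μ'.image Prod.snd).card = a + 1) (h2a : 2 * a ≤ m)
    (hu : (∏ i : ↥μ', ∑ x : Fin m × Fin m, C ((if (e x.1).1 = i.1.1 then ε (e x.1).2 else 0) *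
      (if (e x.2).2 = i.1.2 then δ (e x.2).1 else 0)) * X x) ∈ W)
    (hP : isotypicProj ρ (fun t => spechtCharacter ℂ la t.1 * spechtCharacter ℂ mu t.2) ⟨_, hu⟩ ≠ 0) :
    mu.sortedParts.getD 0 0 + (a + 1) ≤ m := by
  classical
  obtain ⟨rep, hrepμ, hrep⟩ := exists_section_injective μ' Prod.snd ha.symm
  have ham : a ≤ m := by omega
  obtain ⟨ec, -⟩ := exists_splitting_fixing_finset ham ∅ (by simp)
  by_contra hle
  refine hP (boxProd_isotypicProj_eq_zero_of_col ρ ec h2a (by omega) fun g => ?_)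
  apply Subtype.ext
  rw [Submodule.coe_sum, Submodule.coe_zero]
  simp only [hρ]
  exact sum_rename_prod_linForm_eq_zero_of_col ec
    (fun (i : ↥μ') (y : Fin m) => if (e y).2 = i.1.2 then δ (e y).1 else 0)
    (fun i j => colVec_eq_or_disjoint e δ i.1 j.1)
    (fun i k hk hkd => sum_colVec_pow_eq_zero e δ (by omega) (hδ k hk hkd) i.1.2)
    (by rw [Fintype.card_coe]; exact hμ) (fun j => ⟨rep j, hrepμ j⟩)
    (fun j j' hjj => hrep (snd_eq_of_colVec_eq e δ hδ0 ⟨0, hp⟩ hjj))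
    (fun (i : ↥μ') (y : Fin m) => if (e y).1 = i.1.1 then ε (e y).2 else 0) g

end Bounds

/-! ## §4 Survivor types -/

/-- ★★★ SURVIVOR TYPES.  `m = pq`, `p, q ≥ 3`, `d < p`, `d < q`: a window-stable degree-`d` cut of `per_m` by `r` forms
carries a type `λ ⊠ μ` with `f^λ f^μ ≤ r`, `λ₁, μ₁ ≥ m - d` (depth window) and `d ≤ (m - λ₁)(m - μ₁)` (product law).
RIDER: about the TYPES of such cuts only; by itself it bounds nothing super-polynomially; `VP ≠ VNP`, `EqHardBiPerm`,
`EqHardLayered biPermSubst`, `IdealWidthSuperpoly` untouched. [cite: SerreLinearRepresentations1977, §2.6 Thm. 8] -/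
theorem exists_type_of_hasIdealWidthLE {p q d r : ℕ} (hp : 3 ≤ p) (hq : 3 ≤ q) (hdp : d < p) (hdq : d < q)
    (h : HasIdealWidthLE (biPermSubst (p * q)) (perPoly (Fin (p * q)) ℂ) d r) :
    ∃ la mu : Nat.Partition (p * q), numStandardTableaux la * numStandardTableaux mu ≤ r ∧
      p * q ≤ la.sortedParts.getD 0 0 + d ∧ p * q ≤ mu.sortedParts.getD 0 0 + d ∧
      d ≤ (p * q - la.sortedParts.getD 0 0) * (p * q - mu.sortedParts.getD 0 0) := by
  classical
  obtain ⟨ε, hε0, hε⟩ := exists_powSum_free_weights q d hdq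
  obtain ⟨δ, hδ0, hδ⟩ := exists_powSum_free_weights p d hdp
  have h3q : 3 * q ≤ p * q := Nat.mul_le_mul_right q hp
  set m : ℕ := p * q with hm
  have hdm : d ≤ m := by omega
  set e : Fin m ≃ Fin p × Fin q := (finCongr hm).trans finProdFinEquiv.symm
  set I : Ideal (MvPolynomial (Fin m × Fin m) ℂ) := Ideal.comap (blockSubst e ε δ)
    (Ideal.span (Set.range fun k : Fin p × Fin q => (X k : MvPolynomial (Fin p × Fin q) ℂ) ^ 2))
  have hperI : perPoly (Fin m) ℂ ∉ I := fun hI =>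
    coeff_onesExp_blockSubst_perPoly_ne_zero e ε δ hε0 hδ0 (coeff_onesExp_eq_zero_of_mem_sqIdeal (Ideal.mem_comap.1 hI))
  obtain ⟨s, hcard, hhom, hstab, hmem⟩ := h
  obtain ⟨f, hf, hfI⟩ : ∃ f ∈ s, f ∉ I := by
    by_contra hall
    push Not at hall
    exact hperI ((Ideal.span_le.2 fun g hg => hall g hg) hmem)
  set W : Submodule ℂ (MvPolynomial (Fin m × Fin m) ℂ) := Submodule.span ℂ (s : Set (MvPolynomial (Fin m × Fin m) ℂ))
  haveI : FiniteDimensional ℂ W := FiniteDimensional.span_finset ℂ s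
  obtain ⟨ρ, hρ⟩ := exists_representation_of_stable W fun g w hw =>
    (Submodule.map_span_le (rename (Equiv.prodCongr g.1 g.2)).toLinearMap _ _).2
      (fun x hx => rename_prodCongr_mem_span hstab g.1 g.2 hx) (Submodule.mem_map_of_mem hw)
  have hfW : f ∈ W := Submodule.subset_span hf
  obtain ⟨χ, hχT, hPχ⟩ : ∃ χ ∈ (irrChars_finite_holds (Perm (Fin m) × Perm (Fin m))).toFinset,
      ((isotypicProj ρ χ ⟨f, hfW⟩ : W) : MvPolynomial (Fin m × Fin m) ℂ) ∉ I := by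
    by_contra hall
    push Not at hall
    apply hfI
    have key := congrArg Subtype.val (sum_isotypicProj_apply ρ ⟨f, hfW⟩)
    rw [Submodule.coe_sum] at key
    change ((⟨f, hfW⟩ : W) : MvPolynomial (Fin m × Fin m) ℂ) ∈ I
    rw [← key]
    exact Ideal.sum_mem _ fun χ hχ => hall χ hχ
  obtain ⟨ψ, hψ, φ, hφ, hχeq⟩ := exists_eq_boxProd_of_mem_irrChars ((irrChars_finite_holds _).mem_toFinset.mp hχT)
  obtain ⟨la, rfl⟩ : ∃ la : Nat.Partition m, spechtCharacter ℂ la = ψ := by rw [irrChars_perm_eq] at hψ; exact hψ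
  obtain ⟨mu, rfl⟩ : ∃ mu : Nat.Partition m, spechtCharacter ℂ mu = φ := by rw [irrChars_perm_eq] at hφ; exact hφ
  subst hχeq
  have hPne : isotypicProj ρ (fun t => spechtCharacter ℂ la t.1 * spechtCharacter ℂ mu t.2) ⟨f, hfW⟩ ≠ 0 := fun h0 =>
    hPχ (by rw [h0, Submodule.coe_zero]; exact Submodule.zero_mem _)
  have hr : numStandardTableaux la * numStandardTableaux mu ≤ r :=
    (mul_numStandardTableaux_le_finrank ρ hPne).trans ((finrank_span_finset_le_card (R := ℂ) s).trans hcard)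
  have hcoe := coe_isotypicProj ρ hρ (fun t => spechtCharacter ℂ la t.1 * spechtCharacter ℂ mu t.2) ⟨f, hfW⟩
  rw [sum_mul_smul_eq, show (((⟨f, hfW⟩ : W)) : MvPolynomial (Fin m × Fin m) ℂ) = f from rfl] at hcoe
  have hghom : (((isotypicProj ρ (fun t => spechtCharacter ℂ la t.1 * spechtCharacter ℂ mu t.2) ⟨f, hfW⟩ : W)) :
      MvPolynomial (Fin m × Fin m) ℂ).IsHomogeneous d := by
    rw [hcoe, ← mem_homogeneousSubmodule]
    refine Submodule.smul_mem _ _ (Submodule.sum_mem _ fun t _ => Submodule.smul_mem _ _ ?_)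
    rw [mem_homogeneousSubmodule]
    exact (hhom f hf).rename_isHomogeneous
  have hwin : m ≤ la.sortedParts.getD 0 0 + d ∧ m ≤ mu.sortedParts.getD 0 0 + d := by
    by_contra hwin
    apply hPχ
    rw [hcoe, sum_boxProd_smul_rename_eq_zero_of_isHomogeneous hdm hwin (hhom f hf), smul_zero]
    exact Submodule.zero_mem _
  obtain ⟨μ', hpair⟩ := exists_cpair_prod_fibreForm_ne_zero (fun x : Fin m × Fin m => ((e x.1).1, (e x.2).2))
    (fun x : Fin m × Fin m => ε (e x.1).2 * δ (e x.2).1) hPχ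
  have hμd : μ'.card = d := card_eq_of_cpair_prod_fibreForm_ne_zero _ _ hghom hpair
  rw [Finset.prod_congr rfl fun k _ => fibreForm_eq_linForm e ε δ k, ← Finset.prod_coe_sort μ', hcoe,
    cpair_smul_left] at hpair
  set u : MvPolynomial (Fin m × Fin m) ℂ := ∏ i : ↥μ', ∑ x : Fin m × Fin m,
    C ((if (e x.1).1 = i.1.1 then ε (e x.1).2 else 0) * (if (e x.2).2 = i.1.2 then δ (e x.2).1 else 0)) * X x
  set V : Submodule ℂ (MvPolynomial (Fin m × Fin m) ℂ) :=
    Submodule.span ℂ (Set.range fun t : Perm (Fin m) × Perm (Fin m) => rename (Equiv.prodCongr t.1 t.2) u)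
  haveI : FiniteDimensional ℂ V := FiniteDimensional.span_of_finite ℂ (Set.finite_range _)
  obtain ⟨ρu, hρu⟩ := exists_representation_of_stable V fun g w hw => rename_mem_span_translates u g hw
  have huV : u ∈ V := by
    have h1 : rename (Equiv.prodCongr (1 : Perm (Fin m)) (1 : Perm (Fin m))) u ∈ V := Submodule.subset_span ⟨1, rfl⟩
    have hid : (⇑(Equiv.prodCongr (1 : Perm (Fin m)) (1 : Perm (Fin m))) : Fin m × Fin m → Fin m × Fin m) = id :=
      funext fun ⟨i, j⟩ => rfl
    rwa [hid, rename_id_apply] at h1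
  have hPu : isotypicProj ρu (fun t => spechtCharacter ℂ la t.1 * spechtCharacter ℂ mu t.2) ⟨u, huV⟩ ≠ 0 :=
    isotypicProj_ne_zero_of_cpair_ne_zero ρu hρu (boxProd_inv la mu)
      ((isIrrChar_spechtCharacter la).boxProd (isIrrChar_spechtCharacter mu)).apply_one_ne_zero huV
      (mul_ne_zero_iff.1 hpair).2
  have hRC : d ≤ (μ'.image Prod.fst).card * (μ'.image Prod.snd).card := by
    rw [← hμd, ← Finset.card_product]
    exact Finset.card_le_card Finset.subset_product
  have hR : (μ'.image Prod.fst).card ≤ m - la.sortedParts.getD 0 0 := by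
    by_cases hR0 : (μ'.image Prod.fst).card = 0
    · rw [hR0]; exact Nat.zero_le _
    · have ha : (μ'.image Prod.fst).card = ((μ'.image Prod.fst).card - 1) + 1 := by omega
      have hle : (μ'.image Prod.fst).card ≤ d := by rw [← hμd]; exact Finset.card_image_le
      have := getD_add_card_image_fst_le e ε δ ρu hρu (by omega) hε0 hε μ' hμd.le ha (by omega) huV hPu
      omega
  have hC : (μ'.image Prod.snd).card ≤ m - mu.sortedParts.getD 0 0 := by
    by_cases hC0 : (μ'.image Prod.snd).card = 0
    · rw [hC0]; exact Nat.zero_le _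
    · have ha : (μ'.image Prod.snd).card = ((μ'.image Prod.snd).card - 1) + 1 := by omega
      have hle : (μ'.image Prod.snd).card ≤ d := by rw [← hμd]; exact Finset.card_image_le
      have := getD_add_card_image_snd_le e ε δ ρu hρu (by omega) hδ0 hδ μ' hμd.le ha (by omega) huV hPu
      omega
  exact ⟨la, mu, hr, hwin.1, hwin.2, hRC.trans (Nat.mul_le_mul hR hC)⟩

end Summit.ValiantsHypothesis.ValiantsHypothesis.Theorems.EquivariantDialLayersApolarSurvivors
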